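/-
Copyright (c) 2026 the pub-hodgecm-mathlib formalisation cell (harness21).  Prover seat hodgecm-mathlib-LH4-p14 (g6), 2026-09-04 — STAGE-1b tier-0 ED. 6, (H-T+) hand, road (b1)
(LEAD T19-40 (R-30): `Ω := omegaR` inside the statements, discharged by a PROVED covering lemma — never an «Ω = 1» letter).
-/
import Summits.HodgeConjecture.HodgeConjecture.Theorems.F0P3cDyRamAmplShiftAffine          -- ★ p859406 (V7, this seat): `inv_pow_mul_ampl_shift_eq`; brings ★ №1-R2 `OmegaSchedule`, ★ #0a `ampl`, ★ №2c-R places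
import Summits.HodgeConjecture.HodgeConjecture.Theorems.F0P3cDyRamKappaSignLawR2OfRecord    -- ★ p857042 (LH4-p10 (g3)): `exists_slot_data`, `v_sub_one_le_of_relDepth`; brings ★ `omegaR`, ★ `glueSign_eq_one_of_v_sub_one_le`
import HarnessLib

/-!
# H413 · (D-RAM) four-frame programme — THE AFFINE TOKEN LETTER UNDER THE ROOT GUARDS, AND `omegaR = 1` ON DEEP GUARDED SQUARE DATA (slot 2)

LH4-p14 (g6), 2026-09-04.  Companion of `F0P3cDyRamHSideTransvPlusGuarded` (form (A′): the hA letter of `stub_hside_transvPlus` carries the root guards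
`|a − 1|_w < |2|_w`, `|b − 1|_w < |2|_w`).  At `Ω := omegaR` the slot-2 sign `glueSign σ ϖ d (b∕a)` is `1` as soon as `|b∕a − 1| ≤ |ϖ|^{2d−1}`; under the guards
`|a·a − b·b| = |b∕a − 1|·|2|` (★ `v_mul_self_sub_mul_self_eq`), so `|b∕a − 1| = |ϖ|^{n₃ − t}` and the sign is `1` on every datum with `n₃ ≥ 2d − 1 + t` — a DEPTH condition the hA
letter's own floor `N₁ ≤ n₃` can carry.  Contents (all bookkeeping; the guard-free ★ p859406 ∕ p859425 ∕ p859613 re-threaded):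
* §1 `omegaR_two_eq_one_of_le` — `omegaR K σ ϖ d a b 2 = 1` for roots under the guard and an element datum (ANY threshold) with `2d − 1 + t ≤ n₃` (★ `exists_slot_data` +
  ★ `v_sub_one_le_of_relDepth` + ★ `glueSign_eq_one_of_v_sub_one_le`; cf. ★ `omegaR_eq_one_of_deep`, which asks the depth of the datum's THRESHOLD instead);
* §2 (V7″) `affine_token_of_amplShift` — the guarded affine token letter for `A = ampl q (k − ks) (B − bs)` from a sign hypothesis restricted to data with `NΩ ≤ n₃`, floor
  `d + 2(ks + bs) + 2|shift d t_E| + NΩ`;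
* §3 (V8″) `affine_token_linear` — linear combinations of guarded letters (floor `max N₁ N₂`);
* §4 (V9″) `affine_token_of_amplHalfDiff` — the guarded letter for a half-difference token `(ampl q (k−ks₁) (B−bs₁) − ampl q (k−ks₂) (B−bs₂))∕2` (the T₊ token DERIVED of
  ★ №6 `amplTransvPlusDerived` is the instance `(s_T, s_T, s_T + 1, s_T − 1)`), from the same restricted sign hypothesis — which §1 DISCHARGES at `Ω := omegaR`, `NΩ := 2d − 1 + t_E`.
HONEST LABEL: arithmetic bookkeeping only; no census, no law, no row and no crux is proved here; H413 and HC_CM stay OPEN — HC_CM is proved only modulo the 7 printed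
citations (2 remaining named inputs: hLiu418 = stmt-HodgeConjecture-24832, h413 = stmt-HodgeConjecture-24833) until rung 0 closes.
-/

set_option autoImplicit false

noncomputable section

namespace Summit.HodgeConjecture.HodgeConjecture.Cruxes.H413.F0P3cDyRamAmplAffineGuarded

open NumberField IsDedekindDomain
open Literature.NumberTheory.Automorphic Literature.NumberTheory.Automorphic.UnitaryGroup Literature.NumberTheory.GaloisRepresentations
open Literature.NumberTheory.Automorphic.UnitaryThreeFourFrame
open Summit.HodgeConjecture.HodgeConjecture.Cruxes.H413.F0P3cDyRamFourFrameLawDefsR2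
open Summit.HodgeConjecture.HodgeConjecture.Cruxes.H413.F0P3cDyRamOmegaRDefs
open Summit.HodgeConjecture.HodgeConjecture.Cruxes.H413.F0P3cDyRamDiagonalGlueSignEval
open Summit.HodgeConjecture.HodgeConjecture.Cruxes.H413.F0P3cDyRamKappaSignLawR2OfRecord
open scoped Matrix MatrixGroups Classical ValuativeRel WithZero

/-! ## §1  `omegaR = 1` at slot 2 on DEEP guarded square data (any threshold) -/

/-- **`omegaR_two_eq_one_of_le`** — at ANY ramified quadratic datum `(σ, ϖ; d, t)`: for roots `a, b ∈ E¹` under the root guard `|a − 1|, |b − 1| < |2|` and an element datum of the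
squares `(a², b²; n₁, n₂, n₃)` at ANY threshold, if `2d − 1 + t ≤ n₃` then `omegaR K σ ϖ d a b 2 = 1`: the slot-2 unit `b∕a` has `|b∕a − 1|·|ϖ|^t = |ϖ|^{n₃}` (★ `exists_slot_data`),
so `|b∕a − 1| ≤ |ϖ|^{2d−1}` (★ `v_sub_one_le_of_relDepth`) and `u = 1` represents it (★ `glueSign_eq_one_of_v_sub_one_le`).  WITHOUT the guard this fails: `a ↦ −a` keeps the
element datum and flips `glueSign (b∕a)` wherever `−1 ∉ N(E^×)`. [cite: Serre1979, Ch. V §3 Prop. 5, Cor. 3] [cite: Rogawski1990, §4.10 p. 58] -/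
theorem omegaR_two_eq_one_of_le {K : Type} [Field K] [Valued K ℤᵐ⁰] [CompleteSpace K] {σ : K →+* K} {ϖ : K} {d t : ℕ} (hD : IsRamifiedQuadraticDatum σ ϖ d t)
    {a b : K} (ha : a * σ a = 1) (hga : Valued.v (a - 1) < Valued.v (2 : K)) (hgb : Valued.v (b - 1) < Valued.v (2 : K))
    {N₀ n₁ n₂ n₃ : ℕ} (hE : IsElementDatum σ ϖ N₀ (a * a) (b * b) n₁ n₂ n₃) (hn : 2 * d - 1 + t ≤ n₃) :
    omegaR K σ ϖ d a b 2 = 1 := by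
  obtain ⟨c, n, hci, hni, -, hrel⟩ := exists_slot_data hD ha hga hgb hE 2
  have h3 : (n₃ : ℤ) = n := by simpa using hni
  have hn' : (2 * d - 1) + t ≤ n := by omega
  rw [hci]
  exact glueSign_eq_one_of_v_sub_one_le hD (v_sub_one_le_of_relDepth hD.2.2.1 hrel hn')

/-! ## §2  (V7″) the guarded, deep affine token letter of a shifted amplitude -/

/-- **(V7″) `affine_token_of_amplShift`, GUARDED AND DEEP** (★ p859406 §2 with the root guards in both binders and the sign schedule asked to be `1` only on data with `NΩ ≤ n₃`; floor `+ NΩ`). — the hypothesis `hA` of ★ p859212 `hSideIdentity_hFamily_coefAffine_of_affine_token` (equivalently of ★ p859064 (V2)), VERBATIM, for a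
token of the shape `A q d t_E k B = ampl q (k − ks) (B − bs)` (`hAmp`; `ks bs : ℕ` the piece's exponent shifts at this datum) and a sign schedule that is `1` on the slot-`2` element data
(`hΩ` — the covered-cell fact of record), at the LETTERS `cA := C·2·q_w^{−ks}`, `cB := C·4·(q_w^{−ks} − q_w^{shift d t_E − ks + bs})∕(q_w − 1)`, floor `N₁ := d + 2(ks + bs) + 2|shift d t_E|`.
[cite: Rogawski1990, §4.9 Prop. 4.9.1 (b) p. 55, Lemma 4.9.3 (4.9.2) p. 56] [cite: LabesseLanglands1979, §2 (2.2)] -/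
theorem affine_token_of_amplShift (shift : ℕ → ℕ → ℤ) (Ω : OmegaSchedule) (N₀ : ℕ → ℕ) (A : ℕ → ℕ → ℕ → ℕ → ℤ → ℚ)
    (L : Type) [Field L] [NumberField L] [IsCMField L]
    {v : HeightOneSpectrum (𝓞 ↥(maximalRealSubfield L))} (w : UnitaryGroup.PlacesOver L v)
    (hw : IsCMField.complexConj L • w.1 = w.1) (ϖ : (w.1.adicCompletion L)) (d tE : ℕ)
    [Fintype (Valued.ResidueField (w.1.adicCompletion L))] (C : ℂ) (ks bs NΩ : ℕ)
    (hAmp : ∀ (q k : ℕ) (B : ℤ), A q d tE k B = ampl q (k - ks) (B - bs))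
    (hΩ : ∀ (a b : (w.1.adicCompletion L)) (n₁ n₂ n₃ : ℕ),
      a * (galAdicCompletionMap (L := L) (IsCMField.complexConj L) hw) a = 1 → b * (galAdicCompletionMap (L := L) (IsCMField.complexConj L) hw) b = 1 →
      Valued.v (a - 1) < Valued.v (2 : (w.1.adicCompletion L)) → Valued.v (b - 1) < Valued.v (2 : (w.1.adicCompletion L)) →
      IsElementDatum (galAdicCompletionMap (L := L) (IsCMField.complexConj L) hw) ϖ (N₀ d) (a * a) (b * b) n₁ n₂ n₃ → NΩ ≤ n₃ →
      Ω (w.1.adicCompletion L) (galAdicCompletionMap (L := L) (IsCMField.complexConj L) hw) ϖ d a b 2 = 1) :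
    ∀ (a b : (w.1.adicCompletion L)) (n₁ n₂ n₃ k : ℕ) (i : Fin 3) (B : ℤ),
        a * (galAdicCompletionMap (L := L) (IsCMField.complexConj L) hw) a = 1 → b * (galAdicCompletionMap (L := L) (IsCMField.complexConj L) hw) b = 1 →
        Valued.v (a - 1) < Valued.v (2 : (w.1.adicCompletion L)) → Valued.v (b - 1) < Valued.v (2 : (w.1.adicCompletion L)) →
        IsElementDatum (galAdicCompletionMap (L := L) (IsCMField.complexConj L) hw) ϖ (N₀ d) (a * a) (b * b) n₁ n₂ n₃ →
        2 * ((n₁ + n₂) / 2) = n₁ + n₂ → 2 * k + d = n₁ + n₂ + n₃ + 2 → 2 * B = ((![n₁, n₂, n₃] : Fin 3 → ℕ) i : ℤ) - d + 2 - 2 * shift d tE → i = 2 →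
        d + 2 * (ks + bs) + 2 * (shift d tE).natAbs + NΩ ≤ n₃ → (n₃ + d) % 2 = 0 →
        C * ((Fintype.card (Valued.ResidueField (w.1.adicCompletion L)) : ℂ) ^ ((n₁ + n₂) / 2))⁻¹ * (((Ω (w.1.adicCompletion L) (galAdicCompletionMap (L := L) (IsCMField.complexConj L) hw) ϖ d a b i : ℤ) : ℂ) * ((A (Fintype.card (Valued.ResidueField (w.1.adicCompletion L))) d tE k B : ℚ) : ℂ)) =
          (C * ((2 * (Fintype.card (Valued.ResidueField (w.1.adicCompletion L)) : ℚ) ^ (-(ks : ℤ)) : ℚ) : ℂ)) *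
              (((2 * ((Fintype.card (Valued.ResidueField (w.1.adicCompletion L)) : ℚ) ^ (((n₃ - d) / 2 : ℕ) + 1) - 1) / ((Fintype.card (Valued.ResidueField (w.1.adicCompletion L)) : ℚ) - 1) : ℚ)) : ℂ) +
            C * ((4 * ((Fintype.card (Valued.ResidueField (w.1.adicCompletion L)) : ℚ) ^ (-(ks : ℤ)) -
                  (Fintype.card (Valued.ResidueField (w.1.adicCompletion L)) : ℚ) ^ (shift d tE - ks + bs)) / ((Fintype.card (Valued.ResidueField (w.1.adicCompletion L)) : ℚ) - 1) : ℚ) : ℂ) := by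
  intro a b n₁ n₂ n₃ k i B ha hb ha1 hb1 hE hev hk hB hi hN₁ hpar
  subst hi
  have hB' : 2 * B = (n₃ : ℤ) - d + 2 - 2 * shift d tE := by simpa using hB
  -- the row relations: `j = k − m = (n₃ + 2 − d)∕2`, `B = j − S`, `n = (n₃ − d)∕2`
  have hk' : 2 * (k : ℤ) + d = (n₁ : ℤ) + n₂ + n₃ + 2 := by exact_mod_cast hk
  have hev' : 2 * (((n₁ + n₂) / 2 : ℕ) : ℤ) = (n₁ : ℤ) + n₂ := by exact_mod_cast hev
  have hSabs := Int.le_natAbs (a := shift d tE)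
  have hSabs' : -shift d tE ≤ ((shift d tE).natAbs : ℤ) := by
    have h := Int.le_natAbs (a := -shift d tE); rwa [Int.natAbs_neg] at h
  have hdn : d ≤ n₃ := by omega
  have hnn : 2 * (((n₃ - d) / 2 : ℕ) : ℤ) = (n₃ : ℤ) - d := by
    have h2 : 2 * ((n₃ - d) / 2) = n₃ - d := by omega
    have h3 : (((n₃ - d : ℕ) : ℤ)) = (n₃ : ℤ) - d := Nat.cast_sub hdn
    rw [← h3]; exact_mod_cast h2
  have hks : ks ≤ k := by omega
  have hbs : (bs : ℤ) ≤ B := by omega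
  have hq : 1 < Fintype.card (Valued.ResidueField (w.1.adicCompletion L)) := Fintype.one_lt_card
  have key := F0P3cDyRamAmplShiftAffine.inv_pow_mul_ampl_shift_eq (Fintype.card (Valued.ResidueField (w.1.adicCompletion L))) hq ((n₁ + n₂) / 2) k ks hks B (shift d tE)
    ((k : ℤ) - ((n₁ + n₂) / 2 : ℕ)) bs rfl (by omega) hbs ((n₃ - d) / 2) (by omega)
  have keyC := congrArg (fun x : ℚ => (x : ℂ)) key
  rw [hΩ a b n₁ n₂ n₃ ha hb ha1 hb1 hE (by omega), hAmp, Int.cast_one, one_mul]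
  push_cast at keyC ⊢
  rw [mul_assoc, keyC]
  ring

/-! ## §3  (V8″) linear combinations of guarded letters -/

/-- **(V8) `affine_token_linear` — THE `hA` OF ★ p859212 IS LINEAR IN THE TOKEN.**  If `hA` holds for `(A₁; cA₁, cB₁)` above the floor `N₁` and for `(A₂; cA₂, cB₂)` above `N₂`,
and `A = c₁·A₁ + c₂·A₂` pointwise (`c₁ c₂ : ℚ`), then `hA` holds for `(A; c₁cA₁ + c₂cA₂, c₁cB₁ + c₂cB₂)` above `max N₁ N₂` — `push_cast` + `linear_combination`.
Use: T₊ on the derived road, `c₁ = ½`, `c₂ = −½` over the two level tokens at square level `m_c` (★ p859406 §2 supplies `h₁`, `h₂`).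
[cite: Rogawski1990, §4.3 (4.3.1) p. 43; §4.9 Prop. 4.9.1 (b) p. 55] [cite: LabesseLanglands1979, §2 (2.2)] -/
theorem affine_token_linear (shift : ℕ → ℕ → ℤ) (Ω : OmegaSchedule) (N₀ : ℕ → ℕ) (A A₁ A₂ : ℕ → ℕ → ℕ → ℕ → ℤ → ℚ)
    (L : Type) [Field L] [NumberField L] [IsCMField L]
    {v : HeightOneSpectrum (𝓞 ↥(maximalRealSubfield L))} (w : UnitaryGroup.PlacesOver L v)
    (hw : IsCMField.complexConj L • w.1 = w.1) (ϖ : (w.1.adicCompletion L)) (d tE : ℕ)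
    [Fintype (Valued.ResidueField (w.1.adicCompletion L))] (C cA₁ cB₁ cA₂ cB₂ : ℂ) (N₁ N₂ : ℕ) (c₁ c₂ : ℚ)
    (hA12 : ∀ (q k : ℕ) (B : ℤ), A q d tE k B = c₁ * A₁ q d tE k B + c₂ * A₂ q d tE k B)
    (h₁ : ∀ (a b : (w.1.adicCompletion L)) (n₁ n₂ n₃ k : ℕ) (i : Fin 3) (B : ℤ),
        a * (galAdicCompletionMap (L := L) (IsCMField.complexConj L) hw) a = 1 → b * (galAdicCompletionMap (L := L) (IsCMField.complexConj L) hw) b = 1 →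
        Valued.v (a - 1) < Valued.v (2 : (w.1.adicCompletion L)) → Valued.v (b - 1) < Valued.v (2 : (w.1.adicCompletion L)) →
        IsElementDatum (galAdicCompletionMap (L := L) (IsCMField.complexConj L) hw) ϖ (N₀ d) (a * a) (b * b) n₁ n₂ n₃ →
        2 * ((n₁ + n₂) / 2) = n₁ + n₂ → 2 * k + d = n₁ + n₂ + n₃ + 2 → 2 * B = ((![n₁, n₂, n₃] : Fin 3 → ℕ) i : ℤ) - d + 2 - 2 * shift d tE → i = 2 →
        N₁ ≤ n₃ → (n₃ + d) % 2 = 0 →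
        C * ((Fintype.card (Valued.ResidueField (w.1.adicCompletion L)) : ℂ) ^ ((n₁ + n₂) / 2))⁻¹ * (((Ω (w.1.adicCompletion L) (galAdicCompletionMap (L := L) (IsCMField.complexConj L) hw) ϖ d a b i : ℤ) : ℂ) * ((A₁ (Fintype.card (Valued.ResidueField (w.1.adicCompletion L))) d tE k B : ℚ) : ℂ)) =
          cA₁ * (((2 * ((Fintype.card (Valued.ResidueField (w.1.adicCompletion L)) : ℚ) ^ (((n₃ - d) / 2 : ℕ) + 1) - 1) / ((Fintype.card (Valued.ResidueField (w.1.adicCompletion L)) : ℚ) - 1) : ℚ)) : ℂ) + cB₁)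
    (h₂ : ∀ (a b : (w.1.adicCompletion L)) (n₁ n₂ n₃ k : ℕ) (i : Fin 3) (B : ℤ),
        a * (galAdicCompletionMap (L := L) (IsCMField.complexConj L) hw) a = 1 → b * (galAdicCompletionMap (L := L) (IsCMField.complexConj L) hw) b = 1 →
        Valued.v (a - 1) < Valued.v (2 : (w.1.adicCompletion L)) → Valued.v (b - 1) < Valued.v (2 : (w.1.adicCompletion L)) →
        IsElementDatum (galAdicCompletionMap (L := L) (IsCMField.complexConj L) hw) ϖ (N₀ d) (a * a) (b * b) n₁ n₂ n₃ →
        2 * ((n₁ + n₂) / 2) = n₁ + n₂ → 2 * k + d = n₁ + n₂ + n₃ + 2 → 2 * B = ((![n₁, n₂, n₃] : Fin 3 → ℕ) i : ℤ) - d + 2 - 2 * shift d tE → i = 2 →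
        N₂ ≤ n₃ → (n₃ + d) % 2 = 0 →
        C * ((Fintype.card (Valued.ResidueField (w.1.adicCompletion L)) : ℂ) ^ ((n₁ + n₂) / 2))⁻¹ * (((Ω (w.1.adicCompletion L) (galAdicCompletionMap (L := L) (IsCMField.complexConj L) hw) ϖ d a b i : ℤ) : ℂ) * ((A₂ (Fintype.card (Valued.ResidueField (w.1.adicCompletion L))) d tE k B : ℚ) : ℂ)) =
          cA₂ * (((2 * ((Fintype.card (Valued.ResidueField (w.1.adicCompletion L)) : ℚ) ^ (((n₃ - d) / 2 : ℕ) + 1) - 1) / ((Fintype.card (Valued.ResidueField (w.1.adicCompletion L)) : ℚ) - 1) : ℚ)) : ℂ) + cB₂) :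
    ∀ (a b : (w.1.adicCompletion L)) (n₁ n₂ n₃ k : ℕ) (i : Fin 3) (B : ℤ),
        a * (galAdicCompletionMap (L := L) (IsCMField.complexConj L) hw) a = 1 → b * (galAdicCompletionMap (L := L) (IsCMField.complexConj L) hw) b = 1 →
        Valued.v (a - 1) < Valued.v (2 : (w.1.adicCompletion L)) → Valued.v (b - 1) < Valued.v (2 : (w.1.adicCompletion L)) →
        IsElementDatum (galAdicCompletionMap (L := L) (IsCMField.complexConj L) hw) ϖ (N₀ d) (a * a) (b * b) n₁ n₂ n₃ →
        2 * ((n₁ + n₂) / 2) = n₁ + n₂ → 2 * k + d = n₁ + n₂ + n₃ + 2 → 2 * B = ((![n₁, n₂, n₃] : Fin 3 → ℕ) i : ℤ) - d + 2 - 2 * shift d tE → i = 2 →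
        max N₁ N₂ ≤ n₃ → (n₃ + d) % 2 = 0 →
        C * ((Fintype.card (Valued.ResidueField (w.1.adicCompletion L)) : ℂ) ^ ((n₁ + n₂) / 2))⁻¹ * (((Ω (w.1.adicCompletion L) (galAdicCompletionMap (L := L) (IsCMField.complexConj L) hw) ϖ d a b i : ℤ) : ℂ) * ((A (Fintype.card (Valued.ResidueField (w.1.adicCompletion L))) d tE k B : ℚ) : ℂ)) =
          ((c₁ : ℂ) * cA₁ + (c₂ : ℂ) * cA₂) * (((2 * ((Fintype.card (Valued.ResidueField (w.1.adicCompletion L)) : ℚ) ^ (((n₃ - d) / 2 : ℕ) + 1) - 1) / ((Fintype.card (Valued.ResidueField (w.1.adicCompletion L)) : ℚ) - 1) : ℚ)) : ℂ) + ((c₁ : ℂ) * cB₁ + (c₂ : ℂ) * cB₂) := by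
  intro a b n₁ n₂ n₃ k i B ha hb ha1 hb1 hE hev hk hB hi hN hpar
  have e₁ := h₁ a b n₁ n₂ n₃ k i B ha hb ha1 hb1 hE hev hk hB hi (le_trans (le_max_left _ _) hN) hpar
  have e₂ := h₂ a b n₁ n₂ n₃ k i B ha hb ha1 hb1 hE hev hk hB hi (le_trans (le_max_right _ _) hN) hpar
  rw [hA12]
  push_cast at e₁ e₂ ⊢
  linear_combination (c₁ : ℂ) * e₁ + (c₂ : ℂ) * e₂

/-! ## §4  (V9″) the guarded, deep letter of a half-difference token -/

/-- **(V9″) `affine_token_of_amplHalfDiff`, GUARDED AND DEEP** (★ p859613 with the root guards and the `NΩ ≤ n₃` restriction of the sign hypothesis; floor `+ NΩ`). — the `hA` of ★ p859212 for a token `A q d t_E k B = (ampl q (k − ks₁) (B − bs₁) − ampl q (k − ks₂) (B − bs₂)) ∕ 2`, at the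
`½`-combination of ★ (V7)'s letters and the floor `max N₁ N₂`; ★ p859406 §2 ×2 + ★ p859425 (`c₁ = ½`, `c₂ = −½`).  The derived T₊ token of the TEMPLATE is the instance
`(ks₁, bs₁, ks₂, bs₂) = (s, s, s + 1, s − 1)`, `s = d − 1 + ℓ₀`. [cite: Rogawski1990, §4.9 Prop. 4.9.1 (b) p. 55, Lemma 4.9.3 (4.9.2) p. 56] [cite: LabesseLanglands1979, §2 (2.2)] -/
theorem affine_token_of_amplHalfDiff (shift : ℕ → ℕ → ℤ) (Ω : OmegaSchedule) (N₀ : ℕ → ℕ) (A : ℕ → ℕ → ℕ → ℕ → ℤ → ℚ)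
    (L : Type) [Field L] [NumberField L] [IsCMField L]
    {v : HeightOneSpectrum (𝓞 ↥(maximalRealSubfield L))} (w : UnitaryGroup.PlacesOver L v)
    (hw : IsCMField.complexConj L • w.1 = w.1) (ϖ : (w.1.adicCompletion L)) (d tE : ℕ)
    [Fintype (Valued.ResidueField (w.1.adicCompletion L))] (C : ℂ) (ks₁ bs₁ ks₂ bs₂ NΩ : ℕ)
    (hAmp : ∀ (q k : ℕ) (B : ℤ), A q d tE k B = (ampl q (k - ks₁) (B - bs₁) - ampl q (k - ks₂) (B - bs₂)) / 2)
    (hΩ : ∀ (a b : (w.1.adicCompletion L)) (n₁ n₂ n₃ : ℕ),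
      a * (galAdicCompletionMap (L := L) (IsCMField.complexConj L) hw) a = 1 → b * (galAdicCompletionMap (L := L) (IsCMField.complexConj L) hw) b = 1 →
      Valued.v (a - 1) < Valued.v (2 : (w.1.adicCompletion L)) → Valued.v (b - 1) < Valued.v (2 : (w.1.adicCompletion L)) →
      IsElementDatum (galAdicCompletionMap (L := L) (IsCMField.complexConj L) hw) ϖ (N₀ d) (a * a) (b * b) n₁ n₂ n₃ → NΩ ≤ n₃ →
      Ω (w.1.adicCompletion L) (galAdicCompletionMap (L := L) (IsCMField.complexConj L) hw) ϖ d a b 2 = 1) :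
    ∀ (a b : (w.1.adicCompletion L)) (n₁ n₂ n₃ k : ℕ) (i : Fin 3) (B : ℤ),
        a * (galAdicCompletionMap (L := L) (IsCMField.complexConj L) hw) a = 1 → b * (galAdicCompletionMap (L := L) (IsCMField.complexConj L) hw) b = 1 →
        Valued.v (a - 1) < Valued.v (2 : (w.1.adicCompletion L)) → Valued.v (b - 1) < Valued.v (2 : (w.1.adicCompletion L)) →
        IsElementDatum (galAdicCompletionMap (L := L) (IsCMField.complexConj L) hw) ϖ (N₀ d) (a * a) (b * b) n₁ n₂ n₃ →
        2 * ((n₁ + n₂) / 2) = n₁ + n₂ → 2 * k + d = n₁ + n₂ + n₃ + 2 → 2 * B = ((![n₁, n₂, n₃] : Fin 3 → ℕ) i : ℤ) - d + 2 - 2 * shift d tE → i = 2 →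
        max (d + 2 * (ks₁ + bs₁) + 2 * (shift d tE).natAbs + NΩ) (d + 2 * (ks₂ + bs₂) + 2 * (shift d tE).natAbs + NΩ) ≤ n₃ → (n₃ + d) % 2 = 0 →
        C * ((Fintype.card (Valued.ResidueField (w.1.adicCompletion L)) : ℂ) ^ ((n₁ + n₂) / 2))⁻¹ * (((Ω (w.1.adicCompletion L) (galAdicCompletionMap (L := L) (IsCMField.complexConj L) hw) ϖ d a b i : ℤ) : ℂ) * ((A (Fintype.card (Valued.ResidueField (w.1.adicCompletion L))) d tE k B : ℚ) : ℂ)) =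
          (((1/2 : ℚ) : ℂ) * (C * ((2 * (Fintype.card (Valued.ResidueField (w.1.adicCompletion L)) : ℚ) ^ (-(ks₁ : ℤ)) : ℚ) : ℂ)) + ((-1/2 : ℚ) : ℂ) * (C * ((2 * (Fintype.card (Valued.ResidueField (w.1.adicCompletion L)) : ℚ) ^ (-(ks₂ : ℤ)) : ℚ) : ℂ))) * (((2 * ((Fintype.card (Valued.ResidueField (w.1.adicCompletion L)) : ℚ) ^ (((n₃ - d) / 2 : ℕ) + 1) - 1) / ((Fintype.card (Valued.ResidueField (w.1.adicCompletion L)) : ℚ) - 1) : ℚ)) : ℂ) + (((1/2 : ℚ) : ℂ) * (C * ((4 * ((Fintype.card (Valued.ResidueField (w.1.adicCompletion L)) : ℚ) ^ (-(ks₁ : ℤ)) - (Fintype.card (Valued.ResidueField (w.1.adicCompletion L)) : ℚ) ^ (shift d tE - ks₁ + bs₁)) / ((Fintype.card (Valued.ResidueField (w.1.adicCompletion L)) : ℚ) - 1) : ℚ) : ℂ)) + ((-1/2 : ℚ) : ℂ) * (C * ((4 * ((Fintype.card (Valued.ResidueField (w.1.adicCompletion L)) : ℚ) ^ (-(ks₂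 : ℤ)) - (Fintype.card (Valued.ResidueField (w.1.adicCompletion L)) : ℚ) ^ (shift d tE - ks₂ + bs₂)) / ((Fintype.card (Valued.ResidueField (w.1.adicCompletion L)) : ℚ) - 1) : ℚ) : ℂ))) :=
  affine_token_linear shift Ω N₀ A (fun q d' t k B => ampl q (k - ks₁) (B - bs₁)) (fun q d' t k B => ampl q (k - ks₂) (B - bs₂)) L w hw ϖ d tE C
    (C * ((2 * (Fintype.card (Valued.ResidueField (w.1.adicCompletion L)) : ℚ) ^ (-(ks₁ : ℤ)) : ℚ) : ℂ)) (C * ((4 * ((Fintype.card (Valued.ResidueField (w.1.adicCompletion L)) : ℚ) ^ (-(ks₁ : ℤ)) - (Fintype.card (Valued.ResidueField (w.1.adicCompletion L)) : ℚ) ^ (shift d tE - ks₁ + bs₁)) / ((Fintype.card (Valued.ResidueField (w.1.adicCompletion L)) : ℚ) - 1) : ℚ) : ℂ)) (C * ((2 * (Fintype.card (Valued.ResidueField (w.1.adicCompletion L)) : ℚ) ^ (-(ks₂ : ℤ)) : ℚ) : ℂ)) (C * ((4 * ((Fintype.card (Valued.ResidueField (w.1.adicCompletion L)) : ℚ) ^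 (-(ks₂ : ℤ)) - (Fintype.card (Valued.ResidueField (w.1.adicCompletion L)) : ℚ) ^ (shift d tE - ks₂ + bs₂)) / ((Fintype.card (Valued.ResidueField (w.1.adicCompletion L)) : ℚ) - 1) : ℚ) : ℂ)) (d + 2 * (ks₁ + bs₁) + 2 * (shift d tE).natAbs + NΩ) (d + 2 * (ks₂ + bs₂) + 2 * (shift d tE).natAbs + NΩ) (1/2 : ℚ) (-1/2 : ℚ)
    (fun q k B => by rw [hAmp]; ring)
    (affine_token_of_amplShift shift Ω N₀ (fun q d' t k B => ampl q (k - ks₁) (B - bs₁)) L w hw ϖ d tE C ks₁ bs₁ NΩ (fun _ _ _ => rfl) hΩ)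
    (affine_token_of_amplShift shift Ω N₀ (fun q d' t k B => ampl q (k - ks₂) (B - bs₂)) L w hw ϖ d tE C ks₂ bs₂ NΩ (fun _ _ _ => rfl) hΩ)

end Summit.HodgeConjecture.HodgeConjecture.Cruxes.H413.F0P3cDyRamAmplAffineGuarded

end
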